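import Literature.MathematicalPhysics.QuantumFieldTheory.Balaban1983to89.Beta.RemainderChain

/-!
# Bałaban's β-functions: joint continuity (C) on the boxes from TERMWISE continuity of the kernel and uniform decay

T. Bałaban, *Renormalization group approach to lattice gauge field theories. I*, Comm. Math. Phys. **109** (1987)
249–301 [I].  p. 264 [PDF 16], the passage (1.21)–(1.22) in printed order and words (render p016 re-read): *"This
implies Π^{ab}_{j+1,μν}(g_j, x, x′) = δ^{ab}Π_{j+1,μν}(g_j, x − x′), Π_{j+1}(g_j, rb, rb′) = Π_{j+1}(g_j, b, b′), (1.21)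
where Π_{j+1,μν}(g_j, x) is a real valued function, and r is a Euclidean rotation leaving the lattice T^{(j+1)}
invariant. Now we take a limit of these functions as T^{(j+1)} ↗ Z^d. This limit exists by the localized representation
(1.7). The function β_{j+1}(g_j) is defined by β_{j+1}(g_j) = −(∂²/∂p₁∂p₂ Π̃_{j+1,12})(g_j, 0) =
−(∂²/∂p_μ∂p_ν Π̃_{j+1,μν})(g_j, 0) = Σ_x Π_{j+1,μν}(g_j, x)x_μx_ν (1.22) for μ, ν arbitrary, μ ≠ ν, where f̃(p) denotes
the Fourier transform of the function f(x), x ∈ Z^d."* (the exponential decay of the kernel is NOT stated on p. 264; it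
is (5.10)); (5.10) p. 293 [PDF 45]: *"The representation (4.37) yields the following inequality
|Π_{μν}(x − y)| ≤ O(1)E₀ exp(−δ₁|x − y|), (5.10) with a positive constant δ₁ determined by δ₀, κ, and M (e.g.,
δ₁ = 1/2min{δ₀, κM⁻¹})."* (DOCFIX v1.1, GAPS G-beta-11: the v1 string dropped the factor `E₀` and wrote the kernel in the
(1.22)-notation `Π_{j+1}(g_j, ·)` inside the quotation marks; verbatim now, render p045 re-read by the β lead.  DOCFIX
v1.2, GAPS G-pv14-5 (Q1), cross-read C-pv14-20: the v1/v1.1 p. 264 string inverted the printed order and contained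
unprinted connectives; replaced by the printed passage above; docstring-only, every declaration byte-unchanged).  The β
sub-cell's residual input (C) — JOINT CONTINUITY of `β_{k+1}` in the history
`(g_0,…,g_k)` on the boxes `]0,γ]^{k+1}` (`FlowStep.BetaContH γ β := ∀ k, ContinuousOn (β k) (Box γ k)`), needed by every
located consumer of the flow (`FlowStepRuns.thm2Printed_of_boxBoundsH`, `…endpointExistence_of_eventualLower`) and
printed nowhere (print suppresses the history: p. 298 [PDF 50]) — is reduced here, by dominated summation on `ℤ^d`
(Weierstrass M-test, `continuousOn_tsum`), to:

* (C-pt) TERMWISE continuity: for each scale `k` and each site `x ∈ ℤ^d`, the kernel value `Π_{k+1,μν}(g_0,…,g_k; x)`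
  is continuous in the history on the box — a PER-SCALE, PER-SITE statement (no uniformity of any kind); and
* the (5.10) decay with constants uniform in the history on each box (PER-SCALE constants suffice) — for the full kernel
  this is the printed (5.10) (cell GAPS G-B12s-15 for its derivation); for the NON-GAUSSIAN part `Π¹` it is delivered,
  with k-uniform constants, by a remainder chain (`Beta.RemainderChain.PolLeaves.decay510`).

Content ([folklore] real analysis; nothing is asserted about Bałaban's actual kernels — dictionary clauses are
hypotheses named as such):
1. `continuousOn_secondMoment` — the M-test: termwise continuity + `Decay510` uniform on a set ⇒ the (1.22) second moment
   is continuous on that set.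
2. `betaContH_of_kernel` — (C) for a family `β` given by the (1.22) dictionary `β k v = secondMoment (P k v) μ ν` from
   (C-pt) and per-scale uniform decay.
3. `betaContH_of_split_kernel` — (C) for a split family `β = β⁰ + β¹` (`B12Beta.OneLoopSplit`; `β⁰_{k+1}` is
   history-independent) from (C-pt) for the remainder kernel `Π¹` and its per-scale uniform decay.
4. `betaContH_of_chain` — (C) from a REMAINDER CHAIN (row an4, `Beta.RemainderChain.Chain`: the printed leaves by name,
   k-uniform decay of `Π¹`) plus (C-pt) for `Π¹` ALONE: so after `Beta.RemainderChain` the residual (C) of the β sub-cell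
   is exactly the termwise clause (C-pt) for the remainder kernel (cell records BETA-SPEC §6, `BETA/REMAINDER-BETA.md` §6).
5. `thm2Printed_of_remainderChain_pt` / `endpointExistence_of_remainderChain_pt` — row an4's end-to-end statements with
   (C) replaced by (C-pt).

(C-pt) is itself of the printed TYPE (each finite-volume polarization term (4.2) is a derivative at `A = 0` of a function
analytic in `(U, J)` and, through the inductive construction, continuous in the couplings; the `T ↗ ℤ^d` limit (1.21) is
termwise eventually constant by the localized representation (1.7)) but is NOT printed for the history dependence —
it stays a located input (cell GAPS G-an4-1 (iv)).  HONEST FRAMING: discharging the residual inputs would make the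
UV-stability theorem unconditional (a constructive-QFT result) — NOT the continuum limit, NOT the Clay problem; this
file discharges none of them.
-/

namespace Literature.MathematicalPhysics.QuantumFieldTheory.Balaban1983to89.Beta.BetaContinuity

open Literature.MathematicalPhysics.QuantumFieldTheory.Balaban1983to89
open Literature.MathematicalPhysics.QuantumFieldTheory.Balaban1983to89.FlowStep
open Literature.MathematicalPhysics.QuantumFieldTheory.Balaban1983to89.DagBinding
open Literature.MathematicalPhysics.QuantumFieldTheory.Balaban1983to89.FlowStepRuns
open Literature.MathematicalPhysics.QuantumFieldTheory.Balaban1983to89.Beta.RemainderChain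
open Topology Filter

noncomputable section

/-! ## 1. The M-test for the (1.22) second moment -/

/-- **Continuity of the (1.22) second moment from termwise continuity and uniform (5.10) decay** (Weierstrass M-test on
`ℤ^d` with the summable majorant `C·|x|₁²e^{−δ₁|x|₁}` of `B12Sec2to5.majorant_summable`): if `v ↦ Π(v; x)` is continuous
on `s` for every site `x` and `|Π(v; x)| ≤ C e^{−δ₁|x|₁}` for all `v ∈ s` (`δ₁ > 0`), then `v ↦ Σ_x Π(v; x) x_μ x_ν` is
continuous on `s`. [folklore] -/
theorem continuousOn_secondMoment {d : ℕ} {X : Type*} [TopologicalSpace X] {s : Set X} (P : X → B12Beta.Kernel d)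
    (μ ν : Fin d) {C δ₁ : ℝ} (hδ : 0 < δ₁) (hcont : ∀ x : Fin d → ℤ, ContinuousOn (fun v => P v μ ν x) s)
    (hdec : ∀ v ∈ s, B12Sec2to5.Decay510 (P v μ ν) C δ₁) :
    ContinuousOn (fun v => B12Beta.secondMoment (P v) μ ν) s := by
  have hS := (B12Sec2to5.majorant_summable hδ d).mul_left C
  have h := continuousOn_tsum (f := fun (x : Fin d → ℤ) (v : X) => P v μ ν x * (x μ : ℝ) * (x ν : ℝ))
    (fun x => ((hcont x).mul continuousOn_const).mul continuousOn_const) hS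
    (fun x v hv => by
      rw [Real.norm_eq_abs]
      exact B12Sec2to5.abs_term_le_of_decay510 (hdec v hv) μ ν x)
  simpa [B12Beta.secondMoment] using h

/-! ## 2. (C) from the (1.22) dictionary -/

/-- **(C) from termwise continuity (C-pt) and per-scale uniform decay**: if `β_{k+1}(v) = Σ_x Π_{k+1}(v; x) x_μ x_ν` on
the box (the (1.22) dictionary), each `Π_{k+1}(·; x)` is continuous on the box, and at each scale the kernels obey
(5.10) with constants uniform on the box, then `BetaContH γ β`. [cite: Balaban1987RG1, (1.22) p.264 and (5.10) p.293] -/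
theorem betaContH_of_kernel {d : ℕ} (μ ν : Fin d) {β : HBeta} {γ : ℝ}
    (P : (k : ℕ) → (Fin (k + 1) → ℝ) → B12Beta.Kernel d)
    (hβ : ∀ k v, v ∈ Box γ k → β k v = B12Beta.secondMoment (P k v) μ ν)
    (hcont : ∀ k (x : Fin d → ℤ), ContinuousOn (fun v => P k v μ ν x) (Box γ k))
    (hdec : ∀ k, ∃ C δ₁ : ℝ, 0 < δ₁ ∧ ∀ v ∈ Box γ k, B12Sec2to5.Decay510 (P k v μ ν) C δ₁) :
    BetaContH γ β := fun k => by
  obtain ⟨C, δ₁, hδ, hd⟩ := hdec k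
  exact (continuousOn_secondMoment (P k) μ ν hδ (hcont k) hd).congr (fun v hv => hβ k v hv)

/-- **(C) for a split family from the REMAINDER kernel alone**: `β_{k+1} = β⁰_{k+1} + β¹_{k+1}` with `β⁰_{k+1}`
history-independent (`B12Beta.OneLoopSplit`), `β¹_{k+1}(v) = Σ_x Π¹_{k+1}(v; x) x_μ x_ν` on ]0,γ]-histories,
(C-pt) for `Π¹` and per-scale uniform decay of `Π¹` give `BetaContH γ β`. [cite: Balaban1987RG1, (2.12)–(2.14) p.268 and (1.22) p.264] -/
theorem betaContH_of_split_kernel {d : ℕ} (μ ν : Fin d) {β : HBeta} (S : B12Beta.OneLoopSplit β) {γ : ℝ}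
    (P1 : (k : ℕ) → (Fin (k + 1) → ℝ) → B12Beta.Kernel d)
    (hβ1 : ∀ k p, p ∈ B12Beta.HistBox γ k → S.β1 k p = B12Beta.secondMoment (P1 k p) μ ν)
    (hcont : ∀ k (x : Fin d → ℤ), ContinuousOn (fun v => P1 k v μ ν x) (Box γ k))
    (hdec : ∀ k, ∃ C δ₁ : ℝ, 0 < δ₁ ∧ ∀ v ∈ Box γ k, B12Sec2to5.Decay510 (P1 k v μ ν) C δ₁) :
    BetaContH γ β := fun k => by
  obtain ⟨C, δ₁, hδ, hd⟩ := hdec k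
  have h1 : ContinuousOn (fun v => S.β0 k + B12Beta.secondMoment (P1 k v) μ ν) (Box γ k) :=
    continuousOn_const.add (continuousOn_secondMoment (P1 k) μ ν hδ (hcont k) hd)
  exact h1.congr fun v hv => by rw [S.split k v, hβ1 k v (histBox_of_mem_box hv)]

/-! ## 3. (C) after the remainder chain: only the termwise clause is left -/

/-- **(C) from a remainder chain plus (C-pt) for the remainder kernel**: the chain's leaves give the (5.10) decay of
`Π¹_{k+1}(g_0,…,g_k; ·)` with constants uniform in the history (indeed in k), so the only further input for (C) is
termwise continuity of `Π¹_{k+1}(·; x)` in the history, per scale and per site.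
[cite: Balaban1987RG1, (1.22) p.264 and (5.10) p.293; Balaban1988RG2Cluster, (2.41) p.21] -/
theorem betaContH_of_chain {d : ℕ} {μ ν : Fin d} {β : HBeta} {S : B12Beta.OneLoopSplit β} {γ : ℝ} {c : B13.Consts}
    {α₂ B₃ c₁ K₀ K₁ : ℝ} (R : Chain d μ ν S γ c α₂ B₃ c₁ K₀ K₁) (hs : ChainSigns c α₂ B₃ K₀)
    (hcont : ∀ k (x : Fin d → ℤ), ContinuousOn (fun v => R.P1 k v μ ν x) (Box γ k)) : BetaContH γ β :=
  betaContH_of_split_kernel μ ν S R.P1 R.beta1_eq hcont fun k =>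
    ⟨remActivity c * polConst α₂ B₃ c.κ c.δ₀ c.M c₁ K₀ K₁, B12Decay510.delta1 c.δ₀ c.κ c.M,
      B12Decay510.delta1_pos hs.δ₀_pos hs.κ_pos hs.M_pos, fun v hv =>
        (R.leaves k v (histBox_of_mem_box hv)).decay510 hs.α₂_pos hs.act hs.B₃_nonneg hs.K₀_nonneg hs.δ₀_pos.le
          hs.κ_pos.le hs.M_pos⟩

/-- **END TO END, literal grade, with (C) replaced by the termwise clause (C-pt)**: `B12.Thm2Printed C L` from (AF-0)
on all scales, a remainder chain with the printed signs, the ε₁-restriction, (C-pt) for `Π¹` and the printed upper bound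
(`Beta.RemainderChain.thm2Printed_of_remainderChain`).  Inputs by name that no printed source supplies: (AF-0), (C-pt),
the leaves inside `R`.  NOT Theorem 2 unconditionally. [cite: Balaban1987RG1, Thm 2 (0.31) p.259] -/
theorem thm2Printed_of_remainderChain_pt {C : B12.Construction} {β : HBeta} (hgen : ForwardGenerated C β)
    {d : ℕ} {μ ν : Fin d} (S : B12Beta.OneLoopSplit β) {γ₀ : ℝ} {c : B13.Consts} {α₂ B₃ c₁ K₀ K₁ : ℝ}
    (R : Chain d μ ν S γ₀ c α₂ B₃ c₁ K₀ K₁) (hs : ChainSigns c α₂ B₃ K₀) {L b β' : ℝ} (hL : 1 < L)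
    (hγ₀ : 0 < γ₀) (hb : 0 < b) (hAF0 : ∀ k, 2 * b ≤ S.β0 k) (hε₁ : c.ε₁ * remCoeff d c α₂ B₃ c₁ K₀ K₁ ≤ b)
    (hcont : ∀ k (x : Fin d → ℤ), ContinuousOn (fun v => R.P1 k v μ ν x) (Box γ₀ k))
    (hup : BetaUpperH β' γ₀ β) : B12.Thm2Printed C L :=
  thm2Printed_of_remainderChain hgen S R hs hL hγ₀ hb hAF0 hε₁ (betaContH_of_chain R hs hcont) hup

/-- **END-STATEMENT grade with (C) replaced by (C-pt)**: endpoint existence from a one-loop tail bound, a remainder chain,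
the ε₁-restriction, (C-pt) for `Π¹` and the printed two-sided bound
(`Beta.RemainderChain.endpointExistence_of_remainderChain`). [cite: Balaban1987RG1, Thm 2 p.259 (first sentence)] -/
theorem endpointExistence_of_remainderChain_pt {C : B12.Construction} {β : HBeta} (hgen : ForwardGenerated C β)
    {d : ℕ} {μ ν : Fin d} (S : B12Beta.OneLoopSplit β) {γ₀ : ℝ} {c : B13.Consts} {α₂ B₃ c₁ K₀ K₁ : ℝ}
    (R : Chain d μ ν S γ₀ c α₂ B₃ c₁ K₀ K₁) (hs : ChainSigns c α₂ B₃ K₀) {b β' : ℝ} {k₀ : ℕ} (hγ₀ : 0 < γ₀)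
    (hb : 0 < b) (hβ' : 0 ≤ β') (hAF0 : ∀ k, k₀ ≤ k → 2 * b ≤ S.β0 k)
    (hε₁ : c.ε₁ * remCoeff d c α₂ B₃ c₁ K₀ K₁ ≤ b)
    (hcont : ∀ k (x : Fin d → ℤ), ContinuousOn (fun v => R.P1 k v μ ν x) (Box γ₀ k))
    (hlo : ∀ k, ∀ v ∈ Box γ₀ k, -β' ≤ β k v) (hup : BetaUpperH β' γ₀ β) : EndpointExistence C :=
  endpointExistence_of_remainderChain hgen S R hs hγ₀ hb hβ' hAF0 hε₁ (betaContH_of_chain R hs hcont) hlo hup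

end

end Literature.MathematicalPhysics.QuantumFieldTheory.Balaban1983to89.Beta.BetaContinuity
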